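import Mathlib
import Literature.NumberTheory.LFunctions.Zhang2022.Section16Lemma162RGlueMajorant
import Literature.NumberTheory.LFunctions.Zhang2022.Section16Lemma162RAnalytic
import Literature.NumberTheory.LFunctions.Zhang2022.Section16Varpi2TwoPart
import HarnessLib

/-!
# Zhang (2022), §16 Lemma 16.2 at the repaired normaliser (`Lemma162Rq`): the PACKAGING — the
# glue instantiated at the actual Euler factors of `E₂ⱼ`, reducing the sub-leaf to the two open
# per-prime statements (the factor at `2 ∣ D`, and the values at `s = 1`)

Topic `Literature/NumberTheory/LFunctions/Zhang2022` (Landau–Siegel audit tree; verdict-neutral).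
Y. Zhang, *Discrete mean estimates and the Landau–Siegel zero*, arXiv:2211.02515v1 (2022)
[Zhang2022LandauSiegel], §16 Lemma 16.2 p. 94 (tex L4646–L4653) and its Appendix-A sketch pp. 105–106,
**an unrefereed manuscript under adjudication; nothing here asserts or denies its Theorems 1–2.**
Lane ZHANG-L, WP16 Block D (row G-d57-1), sub-leaf `Typed.Section16B.Lemma162Rq c′`.

The glue `Typed.Section16B.lemma162Rq_of_majorant` (file `Section16Lemma162RGlueMajorant`) takes a
family of Euler factors `Φ` with four local hypotheses (M), (D), (E), (V). Here `Φ` is INSTANTIATED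
at the factors of `Lemma162R.hasProd_frakU2SeriesR` (file `Section16Lemma162REuler`):
`Φ_q(s) = (1−x)²(1−q^{βⱼ}x)(1−χ(q)x)(1−χ(q)q^{βⱼ}x)² · C_q(s)`, `x = q^{−s}`, with
`C_2 = Σ_e ϖ₂ⱼ(2^e)(ν∗χ)(2^e)x^e` and `C_q = Σ_e ϖ₂ⱼ^loc(q^e)(ν∗χ)(q^e)x^e` (`q` odd), and (M), (E)
and the odd part of (D) are DISCHARGED from the landed per-prime files:
`Lemma162R.differentiableOn_Phi`, `norm_Phi_sub_one_le_crude`, `norm_Phi_two_sub_one_le_crude`,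
`norm_Phi_sub_one_le` (`q ≥ 700`, `Section16Lemma162RFactor`), `Phi_eq_of_apply_eq_zero`,
`hasProd_frakU2SeriesR`, `half_le_norm_calM2Factor_betaJ_of_le` / `_one_one_small`
(`Section16Lemma162RLocal`), and `Typed.Section16B.two_data_ne_zero` / `norm_varpi2_two_pow_le`
(`Section16Varpi2TwoPart`, the prime `2`). THEOREMS (no definitions, no facts):

* `half_le_norm_calM2Factor_eventually` — (H1) for all large `D`: `‖F_q(1,1;1−βⱼ)‖ ≥ 1/2` at every
  odd prime (`j = 1, 2`);
* **`lemma162Rq_of_values`** — `Lemma162Rq c′` FROM the two remaining per-prime statements: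
  (D₂) the factor at `q = 2` when `2 ∣ D` is `(1 − 2^{−s})²` on `σ > 9/10`, and
  (V) for `q ∤ D`, `q ≤ D`: `‖Φ_q(1) − m_q‖ ≤ C·α·log q/q` (`m_q` the factor of `hasProd_frakU2Main`).

WHAT THIS IS NOT: a proof of (D₂) or (V), or of anything about Theorems 1–2 / Landau–Siegel zeros.

## References

* Y. Zhang, arXiv:2211.02515v1 (2022), §16 Lemma 16.2 p. 94; App. A pp. 105–106.
  [cite: Zhang2022LandauSiegel, §16 Lemma 16.2 p.94]
-/

noncomputable section

open Complex Real Filter Topology Finset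

namespace Literature.NumberTheory.LFunctions.Zhang2022.Lemma162R

open Literature.NumberTheory.LFunctions.Zhang2022
open Literature.NumberTheory.LFunctions.Zhang2022.Skeleton
open Literature.NumberTheory.LFunctions.Zhang2022.Typed.Section16A
open Literature.NumberTheory.LFunctions.Zhang2022.Typed.Section16B

/-! ## Smallness of the shifts and (H1) for all large `D` -/

/-- `𝓛 ≥ M` once `D ≥ ⌈exp M⌉₊`. [cite: Zhang2022LandauSiegel, §2 (2.1)] -/
private theorem le_ell_of_ceil_exp_le {M : ℝ} {D : ℕ} (hD : ⌈Real.exp M⌉₊ ≤ D) : M ≤ ell D := by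
  have hDexp : Real.exp M ≤ D := le_trans (Nat.le_ceil _) (by exact_mod_cast hD)
  have hDpos : (0 : ℝ) < D := lt_of_lt_of_le (Real.exp_pos _) hDexp
  rw [ell]; exact (Real.le_log_iff_exp_le hDpos).mpr hDexp

/-- For `𝓛 ≥ 5π|c′| + 40`: `α ≤ 1/30000`, `|b₁| ≤ 2α`, `‖β₁‖, ‖β₂‖ ≤ 3α`.
[cite: Zhang2022LandauSiegel, §2 (2.13)] -/
private theorem shifts_small (c' : ℝ) {D : ℕ} (hℓ : 5 * π * |c'| + 40 ≤ ell D) :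
    alpha D ≤ 1 / 30000 ∧ |b1 c' D| ≤ 2 * alpha D ∧ ‖beta1 c' D‖ ≤ 3 * alpha D ∧
      ‖beta2 c' D‖ ≤ 3 * alpha D := by
  have hπ3 := Real.pi_gt_three
  have hπ4 := Real.pi_lt_four
  have hℓ40 : (40 : ℝ) ≤ ell D := by nlinarith [abs_nonneg c']
  have hℓ1 : 1 ≤ ell D := by linarith
  have hℓ0 : 0 < ell D := by linarith
  have hα : alpha D = π / ell D ^ 9 := by rw [alpha, bigP, Real.log_exp]
  have hα0 : 0 < alpha D := by rw [hα]; positivity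
  have hℓ9 : ell D ^ 9 ≥ 40 ^ 8 * ell D := by
    have : ell D ^ 8 ≥ 40 ^ 8 := pow_le_pow_left₀ (by norm_num) hℓ40 8
    nlinarith
  have hαsmall : alpha D ≤ 1 / 30000 := by
    rw [hα, div_le_iff₀ (by positivity)]
    nlinarith
  have hαℓ : alpha D * ell D = π / ell D ^ 8 := by rw [hα]; field_simp
  have hαℓ0 : 0 ≤ alpha D * ell D := by positivity
  have hcαℓ : |c'| * (alpha D * ell D) ≤ 1 / 5 := by
    rw [hαℓ]
    have h8 : ell D ≤ ell D ^ 8 := le_self_pow₀ hℓ1 (by norm_num)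
    rw [← mul_div_assoc, div_le_iff₀ (by positivity)]
    nlinarith [abs_nonneg c', Real.pi_pos]
  have hc : |c' * (alpha D * ell D)| ≤ 1 / 5 := by
    rw [abs_mul, abs_of_nonneg hαℓ0]; exact hcαℓ
  have hb1 : |b1 c' D| ≤ 2 * alpha D := by
    rw [b1, abs_mul, abs_of_pos hα0]
    have : |1 - 5 * c' * alpha D * ell D| ≤ 2 := by
      rw [abs_le]; constructor <;> nlinarith [abs_le.mp hc]
    nlinarith
  refine ⟨hαsmall, hb1, ?_, ?_⟩
  · have e : beta1 c' D = (((alpha D * (1 - 5 * c' * alpha D * ell D) : ℝ)) : ℂ) * I := by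
      rw [beta1]; push_cast; ring
    rw [e, norm_mul, Complex.norm_I, mul_one, Complex.norm_real, Real.norm_eq_abs, abs_mul,
      abs_of_pos hα0]
    have : |1 - 5 * c' * alpha D * ell D| ≤ 2 := by
      rw [abs_le]; constructor <;> nlinarith [abs_le.mp hc]
    nlinarith
  · have e : beta2 c' D = (((2 * alpha D * (1 + c' * alpha D * ell D) : ℝ)) : ℂ) * I := by
      rw [beta2]; push_cast; ring
    rw [e, norm_mul, Complex.norm_I, mul_one, Complex.norm_real, Real.norm_eq_abs, abs_mul,
      abs_of_pos (by positivity : (0:ℝ) < 2 * alpha D)]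
    have : |1 + c' * alpha D * ell D| ≤ 3 / 2 := by
      rw [abs_le]; constructor <;> nlinarith [abs_le.mp hc]
    nlinarith

/-- **(H1) for all large `D`**: for `j = 1, 2` and every odd prime `q`,
`‖F_q(1,1;1−βⱼ)‖ ≥ 1/2` (`q ≥ 700`: `half_le_norm_calM2Factor_betaJ_of_le`; `q < 700`:
`half_le_norm_calM2Factor_one_one_small` with `|b₁|, ‖βⱼ‖ ≤ 10⁻⁴` once `𝓛 ≥ 5π|c′| + 40`).
[cite: Zhang2022LandauSiegel, §16 p.93 (u030)] -/
theorem half_le_norm_calM2Factor_eventually (c' : ℝ) :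
    ForAllLarge fun D _ χ => ∀ j ∈ ({1, 2} : Finset ℕ), ∀ q : ℕ, q.Prime → q ≠ 2 →
      1 / 2 ≤ ‖calM2Factor c' χ q 1 1 (1 - betaJ c' D j)‖ := by
  refine ForAllLarge.of_le ⌈Real.exp (5 * π * |c'| + 40)⌉₊ fun D _ χ hD hq _ j hj q hqp hq2 => ?_
  have hℓ : 5 * π * |c'| + 40 ≤ ell D := le_ell_of_ceil_exp_le hD
  obtain ⟨hαs, hb1, hβ1, hβ2⟩ := shifts_small c' hℓ
  have hj' : j = 1 ∨ j = 2 := by simpa using hj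
  have hβj : ‖betaJ c' D j‖ ≤ 3 * alpha D := by
    rcases hj' with rfl | rfl
    · have e : betaJ c' D 1 = beta1 c' D := by simp [betaJ]
      rw [e]; exact hβ1
    · have e : betaJ c' D 2 = beta2 c' D := by simp [betaJ]
      rw [e]; exact hβ2
  by_cases h700 : 700 ≤ q
  · exact half_le_norm_calM2Factor_betaJ_of_le c' χ hqp h700 1 1 j
  · have hb1' : |b1 c' D| ≤ 1 / 10000 := by linarith
    have hβj' : ‖betaJ c' D j‖ ≤ 1 / 10000 := by linarith
    exact half_le_norm_calM2Factor_one_one_small c' χ hqp (not_le.mp h700)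
      (fun h => absurd h hq2) hq hb1' hβj'

/-! ## Small arithmetic facts -/

/-- `χ(q) = 0` for a prime `q ∣ D` (`q` is not a unit mod `D`). [folklore] -/
private theorem chi_eq_zero_of_dvd' {D : ℕ} (χ : DirichletCharacter ℂ D) {q : ℕ} (hq : q.Prime)
    (hqD : q ∣ D) : χ (q : ZMod D) = 0 := by
  apply χ.map_nonunit
  rw [ZMod.isUnit_iff_coprime]
  intro hcop
  have h1 : q ∣ Nat.gcd q D := Nat.dvd_gcd dvd_rfl hqD
  rw [hcop] at h1
  exact hq.one_lt.ne' (Nat.dvd_one.mp h1)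

/-! ## The packaging -/

open scoped Classical in
/-- **`Lemma162Rq c′` from the two remaining per-prime statements** (§16 Lemma 16.2 p. 94; App. A
pp. 105–106; WP16 Block D). With `Φ_q(s)` the Euler factor of `Lemma162R.hasProd_frakU2SeriesR`
(`x = q^{−s}`: `(1−x)²(1−q^{βⱼ}x)(1−χ(q)x)(1−χ(q)q^{βⱼ}x)²` times `Σ_e ϖ₂ⱼ(2^e)(ν∗χ)(2^e)x^e` at
`q = 2`, `Σ_e ϖ₂ⱼ^loc(q^e)(ν∗χ)(q^e)x^e` at odd `q`): HYPOTHESES (D₂) `hdvd2` — for all large `D`,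
under (A), `j = 1, 2`, if `2 ∣ D` then `Φ₂(s) = (1 − 2^{−s})²` on `σ > 9/10`; (V) `hval` — for
`q ∤ D`, `q ≤ D`: `‖Φ_q(1) − m_q‖ ≤ C·α·log q/q`, `m_q` the factor of `hasProd_frakU2Main`.
CONCLUSION: `Typed.Section16B.Lemma162Rq c′`. The hypotheses (M) (majorant: holomorphy
`differentiableOn_Phi`, crude `norm_Phi_sub_one_le_crude` / `norm_Phi_two_sub_one_le_crude`, true
size `norm_Phi_sub_one_le` for `q ≥ 700`), (D) at odd `q ∣ D` (`Phi_eq_of_apply_eq_zero`) and (E)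
(`hasProd_frakU2SeriesR`) of `lemma162Rq_of_majorant` are discharged here, with (H1) from
`half_le_norm_calM2Factor_eventually` and (H2) from `Typed.Section16B.norm_varpi2_two_pow_le`.
[cite: Zhang2022LandauSiegel, §16 Lemma 16.2 p.94] -/
theorem lemma162Rq_of_values (c' : ℝ)
    (hdvd2 : ForAllLarge fun D _ χ => AssumptionA D χ → ∀ j ∈ ({1, 2} : Finset ℕ), 2 ∣ D →
      ∀ s : ℂ, 9 / 10 < s.re →
        (1 - (2 : ℂ) ^ (-s)) ^ 2 * (1 - (2 : ℂ) ^ betaJ c' D j * (2 : ℂ) ^ (-s)) *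
              (1 - χ (2 : ZMod D) * (2 : ℂ) ^ (-s)) *
                (1 - χ (2 : ZMod D) * ((2 : ℂ) ^ betaJ c' D j * (2 : ℂ) ^ (-s))) ^ 2 *
            (∑' e : ℕ, varpi2 c' χ j (2 ^ e) * nuConvChi χ (2 ^ e) * ((2 : ℂ) ^ (-s)) ^ e) =
          (1 - (2 : ℂ) ^ (-s)) ^ 2)
    (hval : ∃ C : ℝ, ForAllLarge fun D _ χ => AssumptionA D χ → ∀ j ∈ ({1, 2} : Finset ℕ),
      ∀ q : ℕ, q.Prime → ¬ q ∣ D → (q : ℝ) ≤ D →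
        ‖(1 - (q : ℂ) ^ (-(1 : ℂ))) ^ 2 * (1 - (q : ℂ) ^ betaJ c' D j * (q : ℂ) ^ (-(1 : ℂ))) *
                (1 - χ (q : ZMod D) * (q : ℂ) ^ (-(1 : ℂ))) *
                  (1 - χ (q : ZMod D) * ((q : ℂ) ^ betaJ c' D j * (q : ℂ) ^ (-(1 : ℂ)))) ^ 2 *
              (if q = 2 then
                  ∑' e : ℕ, varpi2 c' χ j (2 ^ e) * nuConvChi χ (2 ^ e) * ((2 : ℂ) ^ (-(1 : ℂ))) ^ e
                else ∑' e : ℕ, varpi2loc c' χ j (q ^ e) * nuConvChi χ (q ^ e) *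
                  ((q : ℂ) ^ (-(1 : ℂ))) ^ e) -
            (if q = 2 ∧ χ (2 : ZMod D) = 1 then (3 / 8 : ℂ)
              else (1 - (((q : ℂ)) ^ 2)⁻¹) / frakpFactor χ q)‖ ≤
          C * (alpha D * Real.log q / q)) :
    Lemma162Rq c' := by
  -- (H2) with an absolute constant, and (H1), for all large `D`
  obtain ⟨B, hBfal⟩ := norm_varpi2_two_pow_le c'
  have hFev := half_le_norm_calM2Factor_eventually c'
  -- the constants of the majorant
  set K : ℝ := max (8568002 + 4080 * B) 30000000 with hKdef
  refine lemma162Rq_of_majorant c'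
    (fun {D} _ χ j q s =>
      (1 - (q : ℂ) ^ (-s)) ^ 2 * (1 - (q : ℂ) ^ betaJ c' D j * (q : ℂ) ^ (-s)) *
            (1 - χ (q : ZMod D) * (q : ℂ) ^ (-s)) *
              (1 - χ (q : ZMod D) * ((q : ℂ) ^ betaJ c' D j * (q : ℂ) ^ (-s))) ^ 2 *
          (if q = 2 then ∑' e : ℕ, varpi2 c' χ j (2 ^ e) * nuConvChi χ (2 ^ e) * ((2 : ℂ) ^ (-s)) ^ e
            else ∑' e : ℕ, varpi2loc c' χ j (q ^ e) * nuConvChi χ (q ^ e) * ((q : ℂ) ^ (-s)) ^ e))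
    ⟨700, K, ?_⟩ ?_ ?_ hval
  · -- (M): holomorphy, crude bound, true size for `q ≥ 700`
    refine (hFev.and hBfal).mono fun D _ χ hq _ hS hA j hj q hqp => ?_
    obtain ⟨hFD, hBD⟩ := hS
    have hF : ∀ q : ℕ, q.Prime → q ≠ 2 → 1 / 2 ≤ ‖calM2Factor c' χ q 1 1 (1 - betaJ c' D j)‖ :=
      hFD j hj
    have hB : ∀ e : ℕ, ‖varpi2 c' χ j (2 ^ e)‖ ≤ B * ((e : ℝ) + 1) := hBD hA j hj
    have hKcrude : 8568002 + 4080 * B ≤ K := le_max_left _ _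
    have hKtail : (30000000 : ℝ) ≤ K := le_max_right _ _
    refine ⟨?_, ?_, ?_⟩
    · -- holomorphy on `σ > 9/10`
      exact differentiableOn_Phi c' χ j hF hB ⟨q, hqp⟩
    · -- crude bound for `q ∤ D`
      intro hqD s hs
      by_cases h2 : q = 2
      · subst h2
        have h := norm_Phi_two_sub_one_le_crude c' χ j hB hs
        simp only [if_true, Nat.cast_ofNat]
        linarith
      · rw [if_neg h2]
        have h := norm_Phi_sub_one_le_crude c' χ j hqp (hF q hqp h2) hs
        linarith
    · -- true size for `q ≥ 700`, `q ∤ D`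
      intro h700 hqD s hs
      have h2 : q ≠ 2 := by omega
      rw [if_neg h2]
      have hv := apply_eq_one_or_neg_one χ hq hqp hqD
      have h := norm_Phi_sub_one_le c' χ j hqp h700 hv hs
      have hq0 : (0 : ℝ) < q := by exact_mod_cast hqp.pos
      have ha : 0 ≤ ‖(q : ℂ) ^ (-s)‖ / q := by positivity
      have hb : 0 ≤ ‖(q : ℂ) ^ (-s)‖ ^ 2 := by positivity
      calc _ ≤ 8500 * ‖(q : ℂ) ^ (-s)‖ / q + 30000000 * ‖(q : ℂ) ^ (-s)‖ ^ 2 := h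
        _ = 8500 * (‖(q : ℂ) ^ (-s)‖ / q) + 30000000 * ‖(q : ℂ) ^ (-s)‖ ^ 2 := by ring
        _ ≤ K * (‖(q : ℂ) ^ (-s)‖ / q) + K * ‖(q : ℂ) ^ (-s)‖ ^ 2 := by
            have h85 : (8500 : ℝ) ≤ K := by linarith
            exact add_le_add (mul_le_mul_of_nonneg_right h85 ha)
              (mul_le_mul_of_nonneg_right hKtail hb)
        _ = K * (‖(q : ℂ) ^ (-s)‖ / q + ‖(q : ℂ) ^ (-s)‖ ^ 2) := by ring
  · -- (D): the factor at `q ∣ D` is `(1 − q^{−s})²`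
    refine (hFev.and hdvd2).mono fun D _ χ hq _ hS hA j hj q hqp hqD s hs => ?_
    obtain ⟨hFD, hdvd2D⟩ := hS
    by_cases h2 : q = 2
    · subst h2
      have h := hdvd2D hA j hj hqD s hs
      simp only [if_true, Nat.cast_ofNat]
      exact h
    · rw [if_neg h2]
      have hv : χ (q : ZMod D) = 0 := chi_eq_zero_of_dvd' χ hqp hqD
      have hFq : calM2Factor c' χ q 1 1 (1 - betaJ c' D j) ≠ 0 := by
        intro h0
        have h := hFD j hj q hqp h2
        rw [h0, norm_zero] at h
        norm_num at h
      exact Phi_eq_of_apply_eq_zero c' χ j hqp hv hFq (by linarith)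
  · -- (E): the Euler product on `σ > 1`
    refine (hFev.and hBfal).mono fun D _ χ hq _ hS hA j hj s hs => ?_
    obtain ⟨hFD, hBD⟩ := hS
    have hB : ∀ e : ℕ, ‖varpi2 c' χ j (2 ^ e)‖ ≤ B * ((e : ℝ) + 1) := hBD hA j hj
    have hB0 : 0 ≤ B := by
      have h := hB 0
      simp only [pow_zero, Nat.cast_zero, zero_add, mul_one] at h
      exact le_trans (norm_nonneg _) h
    exact hasProd_frakU2SeriesR c' χ j (hFD j hj) hB0 hB hs

open scoped Classical in
/-- **`Lemma162Rp`, `Lemma162R` and the near-one clause on `frakU2R` from the same two per-prime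
statements** (projections `lemma162Rp_of_Rq`, `lemma162R_of_Rq`,
`frakU2R_near_one_bound_of_lemma162Rq_inv`). [cite: Zhang2022LandauSiegel, §16 Lemma 16.2 p.94] -/
theorem lemma162Rp_and_near_one_of_values (c' : ℝ)
    (hdvd2 : ForAllLarge fun D _ χ => AssumptionA D χ → ∀ j ∈ ({1, 2} : Finset ℕ), 2 ∣ D →
      ∀ s : ℂ, 9 / 10 < s.re →
        (1 - (2 : ℂ) ^ (-s)) ^ 2 * (1 - (2 : ℂ) ^ betaJ c' D j * (2 : ℂ) ^ (-s)) *
              (1 - χ (2 : ZMod D) * (2 : ℂ) ^ (-s)) *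
                (1 - χ (2 : ZMod D) * ((2 : ℂ) ^ betaJ c' D j * (2 : ℂ) ^ (-s))) ^ 2 *
            (∑' e : ℕ, varpi2 c' χ j (2 ^ e) * nuConvChi χ (2 ^ e) * ((2 : ℂ) ^ (-s)) ^ e) =
          (1 - (2 : ℂ) ^ (-s)) ^ 2)
    (hval : ∃ C : ℝ, ForAllLarge fun D _ χ => AssumptionA D χ → ∀ j ∈ ({1, 2} : Finset ℕ),
      ∀ q : ℕ, q.Prime → ¬ q ∣ D → (q : ℝ) ≤ D →
        ‖(1 - (q : ℂ) ^ (-(1 : ℂ))) ^ 2 * (1 - (q : ℂ) ^ betaJ c' D j * (q : ℂ) ^ (-(1 : ℂ))) *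
                (1 - χ (q : ZMod D) * (q : ℂ) ^ (-(1 : ℂ))) *
                  (1 - χ (q : ZMod D) * ((q : ℂ) ^ betaJ c' D j * (q : ℂ) ^ (-(1 : ℂ)))) ^ 2 *
              (if q = 2 then
                  ∑' e : ℕ, varpi2 c' χ j (2 ^ e) * nuConvChi χ (2 ^ e) * ((2 : ℂ) ^ (-(1 : ℂ))) ^ e
                else ∑' e : ℕ, varpi2loc c' χ j (q ^ e) * nuConvChi χ (q ^ e) *
                  ((q : ℂ) ^ (-(1 : ℂ))) ^ e) -
            (if q = 2 ∧ χ (2 : ZMod D) = 1 then (3 / 8 : ℂ)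
              else (1 - (((q : ℂ)) ^ 2)⁻¹) / frakpFactor χ q)‖ ≤
          C * (alpha D * Real.log q / q)) :
    Lemma162Rp c' ∧ Lemma162R c' ∧
      ∃ C : ℝ, ForAllLarge fun D _ χ => AssumptionA D χ → ∀ j ∈ ({1, 2} : Finset ℕ),
        ∀ s : ℂ, ‖s - 1‖ ≤ (ell D)⁻¹ → ‖frakU2R c' χ j s‖ ≤ C * ell D := by
  have hRq := lemma162Rq_of_values c' hdvd2 hval
  refine ⟨lemma162Rp_of_Rq c' hRq, lemma162R_of_Rq c' hRq, ?_⟩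
  obtain ⟨C, hC⟩ := frakU2R_near_one_bound_of_lemma162Rq_inv c' hRq
  exact ⟨C, hC.mono fun D _ χ _ _ hS hA j hj s hs => (hS hA j hj).2.2.2.1 s hs⟩

end Literature.NumberTheory.LFunctions.Zhang2022.Lemma162R

end
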